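import Summits.Ventures.PercRepro.S1PoorCapRank
import Summits.Ventures.PercRepro.S1PoorCapSpec
import Summits.Ventures.PercRepro.S1CoreCapBridge

/-!
# PercRepro — THE PLANE-POOR BRIDGE: `#4circ(e) ≤ Q` from `FourCapSpecPoor capPoor ν Q` at a simple point of a
plane-poor 8-spread matroid (p1, gen 34)

`proofs/P1-S2-CORANK6.md` §4n. On a finite plane-poor 8-spread matroid `M` of nullity `ν` in which the point `e`
is SIMPLE (`hs : ∀ p ∈ M.E, e ≠ p → M.eRk {e, p} = 2`: no loops, nothing parallel to `e`), the lines of the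
4-circuits through `e` (`S1CoreCapClasses.config`) form a configuration of weighted classes satisfying every clause
of the plane-poor spec `S1PoorCapSpec.FourCapSpecPoor`: the plane of a 4-circuit through `e` has `≤ 5` points, so
its line has `≥ 3` classes of total weight `|P ∖ {e}| ≤ 4`, each class of size `≤ 2`; two distinct lines share
`≤ 1` class (two planes through `e` sharing two independent directions coincide —
`card_inter_le_one_of_config_of_pair`); the cost clause and the two spread clauses are `S1PoorCapRank`. Each line
carries at most its cap `capPoor k f` (`1 / 4 / 2` on the shapes `(3, 0) / (4, 0) / (3, 1)`:
`ncard_fourCircuitsThrough_in_closure_le_capPoor`). Summing over the lines,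
**`ncard_fourCircuitsThrough_le_of_fourCapSpecPoor`**: `#4circ(e) ≤ Q` whenever `FourCapSpecPoor capPoor ν Q`.
The reduction of an arbitrary point to a simple one (delete the loops and the parallel partners of `e`) is
`S1PoorCapTable`. Axioms: standard.
-/

open scoped Matroid

namespace PercRepro

namespace S1

open Set

open FourCap

variable {α : Type}

open Classical in
/-- **Two distinct lines of the configuration at a simple point share at most one class.** -/
theorem card_inter_le_one_of_config_of_pair (M : Matroid α) [M.Finite] {e : α}
    (hs : ∀ p ∈ M.E, e ≠ p → M.eRk {e, p} = 2) (he : e ∈ M.E) {L L' : Finset (Set α)}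
    (hL : L ∈ config M e) (hL' : L' ∈ config M e) (hne : L ≠ L') : (L ∩ L').card ≤ 1 := by
  by_contra hlt
  push Not at hlt
  obtain ⟨v₁, hv₁, v₂, hv₂, hv12⟩ := Finset.one_lt_card.1 hlt
  obtain ⟨C, ⟨hC, h4, heC⟩, rfl⟩ := mem_config.1 hL
  obtain ⟨C', ⟨hC', h4', heC'⟩, rfl⟩ := mem_config.1 hL'
  obtain ⟨q₁, hq₁E, hq₁e, rfl⟩ := exists_rep_of_mem_lineOf (Finset.mem_inter.1 hv₁).1
  obtain ⟨q₂, hq₂E, hq₂e, rfl⟩ := exists_rep_of_mem_lineOf (Finset.mem_inter.1 hv₂).1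
  have hmem : ∀ q, q ∈ M.E → q ≠ e → ∀ {D : Set α} (hD : M.IsCircuit D) (heD : e ∈ D),
      cls M e q ∈ lineOf M e D → q ∈ M.closure D := by
    intro q hqE hqe D hD heD hq
    have : q ∈ pts (lineOf M e D) := mem_pts.2 ⟨cls M e q, hq, mem_cls_self M hqE hqe.symm⟩
    rw [pts_lineOf M hD.subset_ground heD] at this
    exact this.1
  have hT : ({e, q₁, q₂} : Set α) ⊆ M.closure C ∩ M.closure C' := by
    intro t ht; simp only [mem_insert_iff, mem_singleton_iff] at ht
    rcases ht with rfl | rfl | rfl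
    · exact ⟨M.mem_closure_of_mem' heC (hC.subset_ground heC), M.mem_closure_of_mem' heC' (hC'.subset_ground heC')⟩
    · exact ⟨hmem t hq₁E hq₁e hC heC (Finset.mem_inter.1 hv₁).1, hmem t hq₁E hq₁e hC' heC' (Finset.mem_inter.1 hv₁).2⟩
    · exact ⟨hmem t hq₂E hq₂e hC heC (Finset.mem_inter.1 hv₂).1, hmem t hq₂E hq₂e hC' heC' (Finset.mem_inter.1 hv₂).2⟩
  have hr3 : 3 ≤ M.eRk (M.closure C ∩ M.closure C') := by
    rw [← eRk_triple_eq_three_of_cls_ne_of_pair M hs he hq₁E hq₂E hq₁e.symm hq₂e.symm hv12]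
    exact M.eRk_mono hT
  have hfin : M.eRk (M.closure C ∩ M.closure C') ≠ ⊤ :=
    ne_top_of_le_ne_top (by simp : (3 : ℕ∞) ≠ ⊤)
      ((M.eRk_mono inter_subset_left).trans (eRk_closure_fourCircuit M hC h4).le)
  have h1 := closure_eq_closure_of_subset_closure_of_eRk_le M inter_subset_left
    ((eRk_closure_fourCircuit M hC h4).le.trans hr3) hfin
  have h2 := closure_eq_closure_of_subset_closure_of_eRk_le M inter_subset_right
    ((eRk_closure_fourCircuit M hC' h4').le.trans hr3) hfin
  apply hne
  unfold lineOf
  rw [h1.symm.trans h2]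

/-- **The classes of a line of the plane-poor configuration have at most two points**: the line of a 4-circuit
`C₀ ∋ e` has `≥ 3` classes whose sizes add up to `|cl C₀ ∖ {e}| ≤ 4`. -/
theorem ncard_le_two_of_mem_lineOf_of_planePoor (M : Matroid α) [M.Finite] {e : α}
    (hs : ∀ p ∈ M.E, e ≠ p → M.eRk {e, p} = 2) (he : e ∈ M.E) (hpp : PlanePoor M) {C₀ : Set α}
    (hC₀ : M.IsCircuit C₀) (h4 : C₀.ncard = 4) (heC₀ : e ∈ C₀) {v : Set α} (hv : v ∈ lineOf M e C₀) :
    v.ncard ≤ 2 := by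
  classical
  set P := M.closure C₀ with hPdef
  set L := lineOf M e C₀ with hLdef
  have hPE : P ⊆ M.E := M.closure_subset_ground C₀
  have hPfin : P.Finite := M.ground_finite.subset hPE
  have heP : e ∈ P := M.mem_closure_of_mem' heC₀ (hC₀.subset_ground heC₀)
  have hP5 : P.ncard ≤ 5 := hpp C₀ hC₀ h4
  have hpts : pts L = P \ {e} := pts_lineOf M hC₀.subset_ground heC₀
  have hcls : ∀ v ∈ L, ∃ q ∈ M.E, q ≠ e ∧ v = cls M e q := fun v hv => exists_rep_of_mem_lineOf hv
  have hsum : ∑ u ∈ L, u.ncard ≤ 4 := by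
    rw [← ncard_pts_eq_sum_of_pair M hs he L hcls, hpts]
    have := ncard_sdiff_singleton_add_one heP hPfin
    omega
  have hk3 : 3 ≤ L.card := three_le_card_lineOf M hC₀ h4 heC₀
  have hpos : ∀ u ∈ L.erase v, 1 ≤ u.ncard := by
    intro u hu
    obtain ⟨q, hqE, hqe, rfl⟩ := hcls u (Finset.mem_of_mem_erase hu)
    exact ncard_pos (cls_finite M e q) |>.2 ⟨q, mem_cls_self M hqE hqe.symm⟩
  have h1 : ∑ u ∈ L, u.ncard = v.ncard + ∑ u ∈ L.erase v, u.ncard := (Finset.add_sum_erase L _ hv).symm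
  have h2 : (L.erase v).card ≤ ∑ u ∈ L.erase v, u.ncard := by
    rw [Finset.card_eq_sum_ones]
    exact Finset.sum_le_sum hpos
  have h3 : (L.erase v).card = L.card - 1 := Finset.card_erase_of_mem hv
  omega

/-- **The per-line cap of the plane-poor table**: the 4-circuits through `e` inside the plane of a 4-circuit
`C₀ ∋ e` of a plane-poor matroid number at most `capPoor k f`, where `k` is the number of classes of its line and
`f` the number of fat ones (the shapes are `(3, 0)`, `(4, 0)`, `(3, 1)` only). -/
theorem ncard_fourCircuitsThrough_in_closure_le_capPoor (M : Matroid α) [M.Finite] {e : α}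
    (hs : ∀ p ∈ M.E, e ≠ p → M.eRk {e, p} = 2) (he : e ∈ M.E) (hpp : PlanePoor M) {C₀ : Set α}
    (hC₀ : M.IsCircuit C₀) (h4 : C₀.ncard = 4) (heC₀ : e ∈ C₀) :
    {C : Set α | M.IsCircuit C ∧ C.ncard = 4 ∧ e ∈ C ∧ C ⊆ M.closure C₀}.ncard ≤
      capPoor (lineOf M e C₀).card (fat Set.ncard (lineOf M e C₀)) := by
  classical
  set P := M.closure C₀ with hPdef
  set L := lineOf M e C₀ with hLdef
  have hPE : P ⊆ M.E := M.closure_subset_ground C₀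
  have hPfin : P.Finite := M.ground_finite.subset hPE
  have heP : e ∈ P := M.mem_closure_of_mem' heC₀ (hC₀.subset_ground heC₀)
  have hP5 : P.ncard ≤ 5 := hpp C₀ hC₀ h4
  have hpts : pts L = P \ {e} := pts_lineOf M hC₀.subset_ground heC₀
  have hcls : ∀ v ∈ L, ∃ q ∈ M.E, q ≠ e ∧ v = cls M e q := fun v hv => exists_rep_of_mem_lineOf hv
  have hw : ∀ v ∈ L, v.ncard = 1 ∨ v.ncard = 2 := by
    intro v hv
    obtain ⟨q, hqE, hqe, hvq⟩ := hcls v hv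
    have h1 := ncard_le_two_of_mem_lineOf_of_planePoor M hs he hpp hC₀ h4 heC₀ hv
    have h2 : 0 < v.ncard := by
      rw [hvq]; exact ncard_pos (cls_finite M e q) |>.2 ⟨q, mem_cls_self M hqE hqe.symm⟩
    omega
  have hk3 : 3 ≤ L.card := three_le_card_lineOf M hC₀ h4 heC₀
  have hPc : P.ncard = L.card + fat Set.ncard L + 1 := by
    have h1 := ncard_sdiff_singleton_add_one heP hPfin
    rw [← hpts, ncard_pts_eq_sum_of_pair M hs he L hcls] at h1
    have h2 := wsum_eq_card_add_fat Set.ncard L hw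
    unfold wsum at h2
    omega
  -- the fat classes give M-lines through `e`
  have hfat : ∀ v ∈ L, v.ncard = 2 → ∃ p q, p ≠ q ∧ p ∈ P ∧ q ∈ P ∧ p ≠ e ∧ q ≠ e ∧ v = {p, q} ∧
      M.eRk {e, p, q} ≤ 2 := by
    intro v hv h2
    obtain ⟨q₀, hq₀E, hq₀e, rfl⟩ := hcls v hv
    obtain ⟨p, q, hpq, hv'⟩ := ncard_eq_two.1 h2
    have hp : p ∈ cls M e q₀ := hv' ▸ (by simp)
    have hq : q ∈ cls M e q₀ := hv' ▸ (by simp)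
    have hpP : p ∈ P := by
      have : p ∈ pts L := mem_pts.2 ⟨_, hv, hp⟩
      rw [hpts] at this; exact this.1
    have hqP : q ∈ P := by
      have : q ∈ pts L := mem_pts.2 ⟨_, hv, hq⟩
      rw [hpts] at this; exact this.1
    refine ⟨p, q, hpq, hpP, hqP, ne_of_mem_cls M hp, ne_of_mem_cls M hq, hv', ?_⟩
    have hq' : q ∈ cls M e p := by
      rw [cls_eq_of_mem_of_pair M hs he hq₀E hq₀e.symm hp]; exact hq
    exact eRk_triple_le_two_of_mem_cls M he (mem_ground_of_mem_cls M hp) hq'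
  -- case analysis on the shape `(k, f)`
  have hkf : (L.card = 3 ∧ fat Set.ncard L = 0) ∨ (L.card = 4 ∧ fat Set.ncard L = 0) ∨
      (L.card = 3 ∧ fat Set.ncard L = 1) := by omega
  obtain ⟨capPoor_3_0, capPoor_4_0, capPoor_3_1⟩ := capPoor_values
  rcases hkf with ⟨hk, hf⟩ | ⟨hk, hf⟩ | ⟨hk, hf⟩ <;> rw [hk, hf]
  · -- (3, 0): a 4-point plane carries one 4-subset
    rw [capPoor_3_0]
    have hP4 : P.ncard = 4 := by omega
    have hsub : {C : Set α | M.IsCircuit C ∧ C.ncard = 4 ∧ e ∈ C ∧ C ⊆ P} ⊆ {P} := by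
      rintro C ⟨_, hC4, _, hCP⟩
      exact mem_singleton_iff.2 (eq_of_subset_of_ncard_le hCP (by omega) hPfin)
    exact (ncard_le_ncard hsub (finite_singleton P)).trans (by rw [ncard_singleton])
  · -- (4, 0): the binomial bound `C(4, 3)`
    rw [capPoor_4_0]
    have hQ4 : (P \ {e}).ncard = 4 := by
      have := ncard_sdiff_singleton_add_one heP hPfin; omega
    have := ncard_fourCircuitsThrough_in_plane_le_of_kill M hPE (e := e) (K := ∅) (empty_subset _)
      (fun _ _ _ _ _ h => h)
    rw [hQ4, ncard_empty] at this
    exact this.trans (by decide)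
  · -- (3, 1): the fat entry 2
    rw [capPoor_3_1]
    have hf1 : (L.filter (fun v => v.ncard = 2)).card = 1 := hf
    obtain ⟨v, hv⟩ := Finset.card_eq_one.1 hf1
    have hvL : v ∈ L.filter (fun v => v.ncard = 2) := hv ▸ Finset.mem_singleton_self v
    rw [Finset.mem_filter] at hvL
    obtain ⟨p, q, hpq, hpP, hqP, hpe, hqe, _, hr⟩ := hfat v hvL.1 hvL.2
    exact ncard_fourCircuitsThrough_in_five_plane_fat_le_two M hPE (by omega) heP hpP hqP hpe hqe hpq hr

open Classical in
/-- **THE PLANE-POOR BRIDGE**: on a finite plane-poor 8-spread matroid of nullity `d` in which the point `e` is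
simple, the 4-circuits through `e` number at most `Q` whenever the plane-poor spec `FourCapSpecPoor capPoor d Q`
holds: the lines of the 4-circuits through `e` form a configuration of weighted classes satisfying every clause of
the spec, and each line carries at most its cap. -/
theorem ncard_fourCircuitsThrough_le_of_fourCapSpecPoor (M : Matroid α) [M.Finite] {e : α}
    (hs : ∀ p ∈ M.E, e ≠ p → M.eRk {e, p} = 2) (he : e ∈ M.E) (hpp : PlanePoor M) (hN8 : Spread8 M)
    {d : ℕ} (hd : M.E.encard = M.eRank + d) {Q : ℕ} (hspec : FourCapSpecPoor capPoor d Q) :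
    {C : Set α | M.IsCircuit C ∧ C.ncard = 4 ∧ e ∈ C}.ncard ≤ Q := by
  -- the six clauses
  have h1 : ∀ L ∈ config M e, ∀ v ∈ L, Set.ncard v = 1 ∨ Set.ncard v = 2 := by
    intro L hL v hv
    obtain ⟨C, ⟨hC, h4, heC⟩, rfl⟩ := mem_config.1 hL
    obtain ⟨q, hqE, hqe, hvq⟩ := exists_rep_of_mem_lineOf hv
    have h1 := ncard_le_two_of_mem_lineOf_of_planePoor M hs he hpp hC h4 heC hv
    have h2 : 0 < v.ncard := by
      rw [hvq]; exact ncard_pos (cls_finite M e q) |>.2 ⟨q, mem_cls_self M hqE hqe.symm⟩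
    omega
  have h2 : ∀ L ∈ config M e, 3 ≤ L.card ∧ wsum Set.ncard L ≤ 4 := by
    intro L hL
    obtain ⟨C, ⟨hC, h4, heC⟩, rfl⟩ := mem_config.1 hL
    refine ⟨three_le_card_lineOf M hC h4 heC, ?_⟩
    have hcls : ∀ v ∈ lineOf M e C, ∃ q ∈ M.E, q ≠ e ∧ v = cls M e q := fun v hv => exists_rep_of_mem_lineOf hv
    have hsum := ncard_pts_eq_sum_of_pair M hs he _ hcls
    rw [pts_lineOf M hC.subset_ground heC] at hsum
    have hPfin : (M.closure C).Finite := M.ground_finite.subset (M.closure_subset_ground C)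
    have h5 : (M.closure C).ncard ≤ 5 := hpp C hC h4
    have := ncard_sdiff_singleton_add_one (M.mem_closure_of_mem' heC (hC.subset_ground heC)) hPfin
    unfold wsum
    omega
  have h3 : ∀ L ∈ config M e, ∀ L' ∈ config M e, L ≠ L' → (L ∩ L').card ≤ 1 :=
    fun L hL L' hL' hne => card_inter_le_one_of_config_of_pair M hs he hL hL' hne
  have h4 : ∀ l : List (Finset (Set α)), l.Nodup → (∀ L ∈ l, L ∈ config M e) →
      wsum Set.ncard (unionL l) ≤ d + lineRank l := fun l _ hl => wsum_unionL_le_of_pair M hs hd he l hl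
  have h5 : ∀ l : List (Finset (Set α)), l.Nodup → (∀ L ∈ l, L ∈ config M e) → lineRank l ≤ 2 →
      wsum Set.ncard (unionL l) ≤ 5 :=
    fun l _ hl hr => wsum_unionL_le_add_three_of_lineRank_le M hs hN8 he l hl hr (by decide)
  have h6 : ∀ l : List (Finset (Set α)), l.Nodup → (∀ L ∈ l, L ∈ config M e) → lineRank l ≤ 3 →
      wsum Set.ncard (unionL l) ≤ 6 :=
    fun l _ hl hr => wsum_unionL_le_add_three_of_lineRank_le M hs hN8 he l hl hr (by decide)
  have hsum := hspec (Set α) Set.ncard (config M e) h1 h2 h3 h4 h5 h6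
  -- the fibre count
  have hfin := fourCircuitsThrough_finite M e
  rw [show {C : Set α | M.IsCircuit C ∧ C.ncard = 4 ∧ e ∈ C} = fourCircuitsThrough M e from rfl,
    ncard_eq_toFinset_card _ hfin, Finset.card_eq_sum_card_image (lineOf M e)]
  refine le_trans (Finset.sum_le_sum (fun L hL => ?_)) hsum
  obtain ⟨C₀, ⟨hC₀, h4₀, heC₀⟩, rfl⟩ := mem_config.1 hL
  refine le_trans ?_ (ncard_fourCircuitsThrough_in_closure_le_capPoor M hs he hpp hC₀ h4₀ heC₀)
  rw [← ncard_coe_finset]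
  refine ncard_le_ncard ?_ ((M.ground_finite.finite_subsets).subset (fun C hC => hC.1.subset_ground))
  intro C hC
  rw [Finset.mem_coe, Finset.mem_filter, Set.Finite.mem_toFinset] at hC
  obtain ⟨⟨hCc, hC4, heC⟩, hline⟩ := hC
  refine ⟨hCc, hC4, heC, ?_⟩
  rw [← closure_eq_of_lineOf_eq M hCc.subset_ground hC₀.subset_ground heC heC₀ hline]
  exact M.subset_closure C hCc.subset_ground

end S1

end PercRepro
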